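import Summits.FinalStateConjecture.FinalStateConjecture.Theses.SettleThenCensor
import Literature.Geometry.Lorentzian.QuasiFinalStateDecomposition
import Literature.Geometry.Lorentzian.TameGenericityDiagonal

/-!
# Crux `GenericSettling` — line `birth`: BIRTH SKELETON (BC3; skeleton registrar, 2026-08-17)

Crux item `stmt-FinalStateConjecture-17274`, decl (FIXED, concluded BY NAME in `GenericSettling_of` /
`GenericSettling_proof`):
`Summit.FinalStateConjecture.FinalStateConjecture.Theses.SettleThenCensor.GenericSettling`
(route `route-FinalStateConjecture-SettleThenCensor`, crux rank 2) — the route's ONE generic clause: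
for every data manifold `X`, tame-Christodoulou-generically in the admissible class, every MGHD
SETTLES, i.e. carries an honest sub-extremal `N`-Kerr final-state decomposition of its
self-determined exterior (`O = J⁺(ιX) ∩ I⁻(charted)`, `RaysStayInClosure`, `HasExhaustiveCharts` with
honest radii, `IsFutureOriented`). (= the re-typed final state conjecture minus the censorship and
MGHD-existence conjuncts.)

## The cut — CAPTURE, THEN ASYMPTOTIC STABILITY (the route's own Two-layer plan, now typable:
## `QuasiFinalStateDecomposition` landed in `Literature/Geometry/Lorentzian`)

Klainerman's two notions of stability of a stationary family (C. R. Mécanique 353 (2025) §2.3;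
Klainerman–Szeftel AMS-210 §1.2): ORBITAL ("remains `ε`-close for all late times") versus ASYMPTOTIC
("converges"). The crux asserts the asymptotic statement generically; the line factors it through
the orbital one, with a MARGIN `m > 0` recording how deep inside the sub-extremal moduli space the
reference configuration sits (`N ≤ 1/m` holes, masses in `[m, 1/m]`, `|aᵢ| ≤ (1 − m) Mᵢ`, rapidities
of the holes relative to the radiation frame `γᵢ ≤ 1/m`) and a TOLERANCE FUNCTION `ε(m) > 0`:

* `stub_orbitalCapture` — ORBITAL CAPTURE INTO THE MULTI-KERR BASIN, tame-generically: for EVERY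
  tolerance function `ε : ℝ → ℝ≥0∞`, positive on positive margins, tame-generically in the admissible
  class every MGHD `𝒟` admits a margin `m > 0`, a region `O` and a `C²` `ε(m)`-QUASI final-state
  decomposition `q` of `O` (`QuasiFinalStateDecomposition`: the charts and covering clauses of a
  decomposition, eventual `ε(m)`-closeness instead of convergence) with margin `m`, which is HONEST
  in every other respect: `O = J⁺(ιX) ∩ I⁻(q.charted)`, `RaysStayInClosure 𝒟 O`, exhaustive charts
  with honest growing radii (eventual `ε(m)`-closeness out to `Rᵢ(τ) → ∞`, `Rᵢ ≥ max(r₊, 0) + 1`,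
  and the causal covering of `O` by the certified regions for every chart time), future-oriented
  chart time (orthochronous motions; transported Kerr time vectors / `∂₀` eventually future-directed).
  This is the large-data black box of the conjecture — formation, ringdown into SOME neighbourhood
  of a sub-extremal multi-Kerr configuration, recession of the holes — with the escape from the
  codimension-one thresholds (extremal, naked-singularity) along tame curves; it asks for NO decay.
  [open-problem; XL; the HARDEST stub]
* `stub_orbitalToAsymptotic` — ORBITAL IMPLIES ASYMPTOTIC STABILITY OF SUB-EXTREMAL MULTI-KERR,
  pointwise (no genericity, every admissible datum): there IS a tolerance function `ε(m) > 0` such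
  that every MGHD of an admissible datum admitting, for some margin `m > 0`, an honest
  `ε(m)`-quasi decomposition as above SETTLES (a TRUE decomposition — new charts and nearby
  parameters allowed — with sub-extremal holes and all the honest clauses). Content: no breathers /
  geons / hair `ε`-close to sub-extremal multi-Kerr in vacuum, and late-time decay from an
  `ε`-close regime WITHOUT rates or weighted smallness (Klainerman–Szeftel 2023 and
  Giorgi–Klainerman–Szeftel 2022 give both notions at once for `|a| ≪ M` from weighted Cauchy data;
  full sub-extremal range and `N ≥ 2` open). [open-problem; XL]

Composition `GenericSettling_of` (kernel-checked, no `sorry` of its own): take the tolerance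
function `ε` of Stub B; Stub A at this `ε` makes "some MGHD-wise honest `ε(m)`-quasi decomposition"
tame-generic; Stub B upgrades it to settling POINTWISE on the admissible class; MONOTONICITY of tame
Christodoulou genericity in the property (`IsTameChristodoulouGeneric.mono`, the one algebraic rule
the typed genericity obeys — it is not closed under `∧`, which is why the cut is "one generic clause +
one pointwise upgrade" and not a conjunction) concludes the crux BY NAME.

Logical position (§4, sorry-free): the crux implies Stub A (forgetful map
`FinalStateDecomposition.toQuasi`, margin read off the finitely many sub-extremal holes) — Stub A is
a genuine WEAKENING (the quasi charts may depend on `ε`); Stub B is implied neither by the crux nor by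
the summit and implies neither (it is a pointwise rigidity/decay statement about vacuum MGHDs that
happen to be orbitally captured). No stub alone is the crux or the summit (BC3 probes, `Lines/birth.md`).

## BC3 probes (seat folder `bc/GenericSettling_probe_{A,B}_{crux,summit}.lean`; they import the route
## file + the two Literature modules — NOT this skeleton — and restate the stub signature verbatim as `S`)
For each stub `S`: `S → GenericSettling` and `S → FinalStateConjecture` by
`first | exact? | simpa [S] | (unfold S; simpa) | aesop` (400 000 heartbeats), and again with each
alternative on its own budget plus `intro h; exact?`: all 4 × 6 attempts FAIL (`exact?`: "could not
close the goal"; `aesop`: "failed to prove the goal after exhaustive search"; `simpa`: heartbeat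
timeout). Log in `Lines/birth.md`.

## Disproof used
None on this crux: it has no `Disproof.lean` / `Negative/` lemma (`ledger crux ls
stmt-FinalStateConjecture-17274`: no workfiles before this one) and `ledger negatives --problem
FinalStateConjecture` lists one unrelated refutation (`not_UniformPhotonSphereChannels`, a Regge–Wheeler
channel estimate); no stub is an instance of it. Cross-crux negative honoured: the time-REVERSED Kerr
patch of `Theorems/CaptureSufficesC2/Negative/ReversedKerrChart.lean` (convergence verbatim, exhaustion
at later chart times false) is NOT an instance of the quasi property of Stub A / hypothesis of Stub B,
which keep the exhaustion clause for EVERY chart time, the orientation clauses and `O = J⁺(ιX) ∩ I⁻(charted)`.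
The stubs are typed over the T2 re-typed notions only (tame genericity on ONE fixed end — burial
families are not tame; honest radii; `RaysStayInClosure`; future orientation).
-/

noncomputable section

-- D-0017: single-problem summit, `Summit.<S>.<S>.…` by design (cf. lakefile `weak.linter.dupNamespace`).
set_option linter.dupNamespace false

namespace Summit.FinalStateConjecture.FinalStateConjecture.Cruxes.GenericSettling.Birth

open Set Filter Function Topology TopologicalSpace
open scoped Manifold ContDiff Classical ENNReal
open Literature.Geometry.Lorentzian
open Summit.FinalStateConjecture.FinalStateConjecture.Theses.SettleThenCensor

/-! ## §0 Vocabulary (readability only: used in the named statements, the composition and §4; NO stub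
signature mentions it — the stubs are stated EXPANDED over Statement + Literature declarations) -/

section Vocabulary

variable {X : Type} [TopologicalSpace X] [ChartedSpace E3 X] [IsManifold (𝓡 3) ∞ X]
  [ConnectedSpace X]

/-- **The MGHD `𝒟` settles down to finitely many sub-extremal Kerr black holes plus radiation**,
honestly — verbatim the crux's per-development property: an exterior region `O` and a `C²`
final-state decomposition `d` of it with every `(Mᵢ, aᵢ)` sub-extremal, `O = J⁺(ιX) ∩ I⁻(charted)`,
`RaysStayInClosure`, exhaustive charts with honest radii, future-oriented chart time.
[cite: DafermosLuk2017, Conjecture 1] -/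
abbrev Settles {D : InitialDataSet (𝓡 3) X} (𝒟 : VacuumCauchyDevelopment D) : Prop :=
  ∃ (O : Set 𝒟.carrier) (d : FinalStateDecomposition 𝒟.toSpacetime O 2),
    (∀ i, Kerr.IsSubextremal (d.mass i) (d.spin i)) ∧
      O = Summit.FinalStateConjecture.exteriorOf 𝒟.toCauchyDevelopment d.charted ∧
        Summit.FinalStateConjecture.RaysStayInClosure 𝒟.toCauchyDevelopment O ∧
          Summit.FinalStateConjecture.HasExhaustiveCharts d ∧
            Summit.FinalStateConjecture.IsFutureOriented d

end Vocabulary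

section QuasiVocabulary

variable {𝓢 : Spacetime.{0} 4} {O : Set 𝓢.carrier} {ε : ℝ≥0∞}

/-- **The quasi decomposition `q` has margin `m`**: at most `1/m` holes, masses in `[m, 1/m]`,
spins `|aᵢ| ≤ (1 − m) Mᵢ` (extremality gap `≥ m`), and Lorentz factors of the holes' motions relative
to the radiation frame `(Λᵢ e₀)⁰ ≤ 1/m` — the reference configuration ranges over a COMPACT part of the
sub-extremal moduli space, on which a tolerance may be chosen uniformly. Klainerman 2025, §2.3
(orbital stability "in some norm"). [cite: Klainerman2025, §2.3] -/
def HasMargin (q : QuasiFinalStateDecomposition 𝓢 O 2 ε) (m : ℝ) : Prop :=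
  (q.N : ℝ) ≤ m⁻¹ ∧ ∀ i, m ≤ q.mass i ∧ q.mass i ≤ m⁻¹ ∧ |q.spin i| ≤ (1 - m) * q.mass i ∧
    ((q.motion i).1 : E4 ≃L[ℝ] E4) (E4.basisVector 0) 0 ≤ m⁻¹

/-- **Honest quasi-exhaustiveness** — verbatim `Summit.FinalStateConjecture.HasExhaustiveCharts`
(honest growing radii `Rᵢ → ∞`, `Rᵢ ≥ max(r₊, 0) + 1`; causal covering of `O` by the certified regions
for EVERY chart time `τ₁ > τ₀`) with the growing-radii CONVERGENCE clause replaced by EVENTUAL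
`ε`-CLOSENESS out to `Rᵢ(τ)` (cf. `QuasiFinalStateDecomposition.HasExhaustiveCharts`, which lacks the
honest-radii conjunct). [cite: DafermosLuk2017, Conjecture 1 (b)] -/
def QuasiHasExhaustiveCharts (q : QuasiFinalStateDecomposition 𝓢 O 2 ε) : Prop :=
  ∃ R : Fin q.N → ℝ → ℝ,
    (∀ i, Tendsto (R i) atTop atTop ∧ ∀ τ, max (Kerr.rPlus (q.mass i) (q.spin i)) 0 + 1 ≤ R i τ) ∧
    (∀ i, ∀ᶠ τ in atTop, 𝓢.truncDeviationCk (q.background i) (q.chart i) 2 (R i τ) τ ≤ ε) ∧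
    ∀ τ₁ : ℝ, q.τ₀ < τ₁ →
      O \ q.certifiedLate R τ₁ ⊆ 𝓢.metric.causalPast 𝓢.timeOrientation (q.certifiedSlab R τ₁)

/-- **Quasi future orientation** — verbatim `Summit.FinalStateConjecture.IsFutureOriented` read in the
charts of the quasi decomposition `q`: orthochronous motions; on the truncated Kerr–Schild slabs the
push-forwards of the boosted backgrounds' future timelike fields `Λᵢ V_{Mᵢ,aᵢ}`, and on the flat
slabs the push-forward of `∂₀`, eventually future-directed. [cite: arXiv08110354, §5.1] -/
def QuasiIsFutureOriented (q : QuasiFinalStateDecomposition 𝓢 O 2 ε) : Prop :=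
  (∀ i, Summit.FinalStateConjecture.IsOrthochronous (q.motion i).1) ∧
  (∀ i (ρ : ℝ), ∀ᶠ τ in atTop, ∀ x ∈ (q.background i).truncTimeSlab ρ τ,
    𝓢.timeOrientation.IsFutureDirected
      (mfderiv 𝓘(ℝ, E4) (𝓡 4) (q.chart i) x
        (((q.motion i).1 : E4 ≃L[ℝ] E4)
          (Kerr.timeVector (q.mass i) (q.spin i)
            (poincareInv (q.motion i).1 (q.motion i).2 (x : E4)))))) ∧
  ∀ᶠ τ in atTop, ∀ x ∈ (Minkowski.backgroundOn q.flatDomain).timeSlab τ,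
    𝓢.timeOrientation.IsFutureDirected
      (mfderiv 𝓘(ℝ, E4) (𝓡 4) q.flatChart x (E4.basisVector 0))

end QuasiVocabulary

section Vocabulary₂

variable {X : Type} [TopologicalSpace X] [ChartedSpace E3 X] [IsManifold (𝓡 3) ∞ X]
  [ConnectedSpace X]

/-- **The MGHD `𝒟` is orbitally captured at tolerance `ε`** (quasi-settles): for some margin `m > 0`
it carries an HONEST `C²` `ε(m)`-quasi final-state decomposition of its self-determined exterior —
margin `m`, `O = J⁺(ιX) ∩ I⁻(q.charted)`, `RaysStayInClosure`, honest quasi-exhaustive, future-oriented.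
Klainerman 2025, §1.1.1 and §2.3. [cite: Klainerman2025, §2.3] -/
abbrev QuasiSettles (ε : ℝ → ℝ≥0∞) {D : InitialDataSet (𝓡 3) X} (𝒟 : VacuumCauchyDevelopment D) :
    Prop :=
  ∃ (m : ℝ) (O : Set 𝒟.carrier) (q : QuasiFinalStateDecomposition 𝒟.toSpacetime O 2 (ε m)),
    0 < m ∧ HasMargin q m ∧
      O = Summit.FinalStateConjecture.exteriorOf 𝒟.toCauchyDevelopment q.charted ∧
        Summit.FinalStateConjecture.RaysStayInClosure 𝒟.toCauchyDevelopment O ∧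
          QuasiHasExhaustiveCharts q ∧ QuasiIsFutureOriented q

end Vocabulary₂

/-! ## §1 The two statements of the line (named; nothing here is a route item) -/

/-- **ORBITAL CAPTURE INTO THE MULTI-KERR BASIN, tame-generically** (`stub_orbitalCapture`): for
every tolerance function `ε`, positive on positive margins, and every connected Hausdorff
second-countable `3`-manifold `X`, tame-generically in the admissible class (Christodoulou
codimension `1`; witness curves on ONE fixed asymptotically flat end, `wDist`-continuous, immersed at
`0`) every MGHD is orbitally captured at tolerance `ε` (`QuasiSettles`). The large-data black box
of the final state conjecture in its ORBITAL form: no decay is asked. Why it might fail: it contains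
large-data collapse/ringdown into SOME neighbourhood of a sub-extremal multi-Kerr configuration for
generic data, `N ≥ 2` recession, and the TAME curve-escapability of the codimension-one extremal
(arXiv:2402.10190, Kehle–Unger) and naked-singularity (Christodoulou 1999,
Rodnianski–Shlapentokh-Rothman) thresholds — all unproved; burial witnesses are excluded by tameness.
[cite: DafermosLuk2017, §1.2.1 (p. 8)] [cite: Klainerman2025, §2.3] [cite: KehleUnger2025] -/
def OrbitalCapture : Prop :=
  ∀ ε : ℝ → ℝ≥0∞, (∀ m, 0 < m → 0 < ε m) →
    ∀ (X : Type) [TopologicalSpace X] [ChartedSpace E3 X] [IsManifold (𝓡 3) ∞ X] [T2Space X]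
      [SecondCountableTopology X] [ConnectedSpace X],
      InitialDataSet.IsTameChristodoulouGeneric (admissibleVacuumData X)
        (fun D ↦ ∀ 𝒟 : VacuumCauchyDevelopment D, 𝒟.IsMaximal → QuasiSettles ε 𝒟) 1

/-- **ORBITAL IMPLIES ASYMPTOTIC STABILITY OF SUB-EXTREMAL MULTI-KERR, pointwise**
(`stub_orbitalToAsymptotic`): there is a tolerance function `ε`, positive on positive margins, such
that for every admissible datum (NO genericity) every MGHD that is orbitally captured at tolerance `ε`
settles honestly (`Settles`: a true `C²` decomposition — new charts, nearby parameters — with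
sub-extremal holes, `O = J⁺(ιX) ∩ I⁻(charted)`, `RaysStayInClosure`, honest exhaustive charts,
future orientation). Why it might fail: the typed `ε`-closeness carries no rates and no weighted
smallness (uniform `C²` on unbounded flat slabs), so no known stability theorem restarts from a
certified slab; nonlinear asymptotic stability is known only for `|a| ≪ M` (Klainerman–Szeftel,
Giorgi–Klainerman–Szeftel) and codimension-3 near Schwarzschild (DHRT), the full sub-extremal range
only linearly (Shlapentokh-Rothman–Teixeira da Costa), `N ≥ 2` not at all; an `ε`-small time-periodic
or non-decaying vacuum exterior (breather) inside the basin would refute it.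
[cite: KlainermanSzeftel2023] [cite: GiorgiKlainermanSzeftel2022] [cite: Klainerman2025, §2.3]
[cite: ShlapentokhrothmanCosta2023] [cite: DafermosHolzegelRodnianskiTaylor2021] -/
def OrbitalToAsymptotic : Prop :=
  ∃ ε : ℝ → ℝ≥0∞, (∀ m, 0 < m → 0 < ε m) ∧
    ∀ (X : Type) [TopologicalSpace X] [ChartedSpace E3 X] [IsManifold (𝓡 3) ∞ X] [T2Space X]
      [SecondCountableTopology X] [ConnectedSpace X],
      ∀ D ∈ admissibleVacuumData X, ∀ 𝒟 : VacuumCauchyDevelopment D, 𝒟.IsMaximal →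
        QuasiSettles ε 𝒟 → Settles 𝒟

/-! ### Statements of the registered stubs, under the stub names
The skeleton audit reads the hypotheses of `GenericSettling_of` BY NAME: each head is a declared stub. -/
namespace Goal

/-- Statement of `stub_orbitalCapture`. -/
abbrev stub_orbitalCapture : Prop := OrbitalCapture
/-- Statement of `stub_orbitalToAsymptotic`. -/
abbrev stub_orbitalToAsymptotic : Prop := OrbitalToAsymptotic

end Goal

/-! ## §2 Registered stubs (the two `sorry`s of the file), stated EXPANDED over existing declarations
(Statement + Literature prelude only; no vocabulary of this file occurs in a stub signature). -/

/-- **Stub A** (XL, open-problem; the hardest): orbital capture into the multi-Kerr basin,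
tame-generically, at every tolerance — see `OrbitalCapture`. [cite: DafermosLuk2017, §1.2.1 (p. 8)]
[cite: Klainerman2025, §2.3] -/
theorem stub_orbitalCapture : ∀ ε : ℝ → ℝ≥0∞, (∀ m : ℝ, 0 < m → 0 < ε m) → ∀ (X : Type) [TopologicalSpace X] [ChartedSpace E3 X] [IsManifold (𝓡 3) (⊤ : ℕ∞) X] [T2Space X] [SecondCountableTopology X] [ConnectedSpace X], InitialDataSet.IsTameChristodoulouGeneric (admissibleVacuumData X) (fun D ↦ ∀ 𝒟 : VacuumCauchyDevelopment D, 𝒟.IsMaximal → ∃ (m : ℝ) (O : Set 𝒟.carrier) (q : QuasiFinalStateDecomposition 𝒟.toSpacetime O 2 (ε m)), 0 < m ∧ ((q.N : ℝ) ≤ m⁻¹ ∧ ∀ i, m ≤ q.mass i ∧ q.mass i ≤ m⁻¹ ∧ |q.spin i| ≤ (1 - m) * q.mass i ∧ ((q.motion i).1 : E4 ≃L[ℝ] E4) (E4.basisVector 0) 0 ≤ m⁻¹) ∧ O = Summit.FinalStateConjecture.exteriorOf 𝒟.toCauchyDevelopment q.charted ∧ Summit.FinalStateConjecture.RaysStayInClosure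 𝒟.toCauchyDevelopment O ∧ (∃ R : Fin q.N → ℝ → ℝ, (∀ i, Tendsto (R i) atTop atTop ∧ ∀ τ, max (Kerr.rPlus (q.mass i) (q.spin i)) 0 + 1 ≤ R i τ) ∧ (∀ i, ∀ᶠ τ in atTop, 𝒟.toSpacetime.truncDeviationCk (q.background i) (q.chart i) 2 (R i τ) τ ≤ ε m) ∧ ∀ τ₁ : ℝ, q.τ₀ < τ₁ → O \ q.certifiedLate R τ₁ ⊆ 𝒟.metric.causalPast 𝒟.timeOrientation (q.certifiedSlab R τ₁)) ∧ ((∀ i, Summit.FinalStateConjecture.IsOrthochronous (q.motion i).1) ∧ (∀ i (ρ : ℝ), ∀ᶠ τ in atTop, ∀ x ∈ (q.background i).truncTimeSlab ρ τ, 𝒟.timeOrientation.IsFutureDirected (mfderiv 𝓘(ℝ, E4) (𝓡 4) (q.chart i) x (((q.motion i).1 : E4 ≃L[ℝ] E4) (Kerr.timeVector (q.mass i) (q.spin i) (poincareInv (q.motion i).1 (q.motion i).2 (x : E4)))))) ∧ ∀ᶠ τ in atTop, ∀ x ∈ (Minkowski.backgroundOn q.flatDomain).timeSlab τ, 𝒟.timeOrientation.IsFutureDirected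 (mfderiv 𝓘(ℝ, E4) (𝓡 4) q.flatChart x (E4.basisVector 0)))) 1 := by
  sorry

/-- **Stub B** (XL, open-problem): orbital implies asymptotic stability of sub-extremal multi-Kerr,
pointwise on the admissible class — see `OrbitalToAsymptotic`. [cite: KlainermanSzeftel2023]
[cite: Klainerman2025, §2.3] -/
theorem stub_orbitalToAsymptotic : ∃ ε : ℝ → ℝ≥0∞, (∀ m : ℝ, 0 < m → 0 < ε m) ∧ ∀ (X : Type) [TopologicalSpace X] [ChartedSpace E3 X] [IsManifold (𝓡 3) (⊤ : ℕ∞) X] [T2Space X] [SecondCountableTopology X] [ConnectedSpace X], ∀ D ∈ admissibleVacuumData X, ∀ 𝒟 : VacuumCauchyDevelopment D, 𝒟.IsMaximal → (∃ (m : ℝ) (O : Set 𝒟.carrier) (q : QuasiFinalStateDecomposition 𝒟.toSpacetime O 2 (ε m)), 0 < m ∧ ((q.N : ℝ) ≤ m⁻¹ ∧ ∀ i, m ≤ q.mass i ∧ q.mass i ≤ m⁻¹ ∧ |q.spin i| ≤ (1 - m) * q.mass i ∧ ((q.motion i).1 : E4 ≃L[ℝ] E4) (E4.basisVector 0) 0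 ≤ m⁻¹) ∧ O = Summit.FinalStateConjecture.exteriorOf 𝒟.toCauchyDevelopment q.charted ∧ Summit.FinalStateConjecture.RaysStayInClosure 𝒟.toCauchyDevelopment O ∧ (∃ R : Fin q.N → ℝ → ℝ, (∀ i, Tendsto (R i) atTop atTop ∧ ∀ τ, max (Kerr.rPlus (q.mass i) (q.spin i)) 0 + 1 ≤ R i τ) ∧ (∀ i, ∀ᶠ τ in atTop, 𝒟.toSpacetime.truncDeviationCk (q.background i) (q.chart i) 2 (R i τ) τ ≤ ε m) ∧ ∀ τ₁ : ℝ, q.τ₀ < τ₁ → O \ q.certifiedLate R τ₁ ⊆ 𝒟.metric.causalPast 𝒟.timeOrientation (q.certifiedSlab R τ₁)) ∧ ((∀ i, Summit.FinalStateConjecture.IsOrthochronous (q.motion i).1) ∧ (∀ i (ρ : ℝ), ∀ᶠ τ in atTop, ∀ x ∈ (q.background i).truncTimeSlab ρ τ, 𝒟.timeOrientation.IsFutureDirected (mfderiv 𝓘(ℝ, E4) (𝓡 4) (q.chart i) x (((q.motion i).1 : E4 ≃L[ℝ] E4) (Kerr.timeVector (q.mass i) (q.spin i) (poincareInv (q.motion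 i).1 (q.motion i).2 (x : E4)))))) ∧ ∀ᶠ τ in atTop, ∀ x ∈ (Minkowski.backgroundOn q.flatDomain).timeSlab τ, 𝒟.timeOrientation.IsFutureDirected (mfderiv 𝓘(ℝ, E4) (𝓡 4) q.flatChart x (E4.basisVector 0)))) → ∃ (O : Set 𝒟.carrier) (d : FinalStateDecomposition 𝒟.toSpacetime O 2), (∀ i, Kerr.IsSubextremal (d.mass i) (d.spin i)) ∧ O = Summit.FinalStateConjecture.exteriorOf 𝒟.toCauchyDevelopment d.charted ∧ Summit.FinalStateConjecture.RaysStayInClosure 𝒟.toCauchyDevelopment O ∧ Summit.FinalStateConjecture.HasExhaustiveCharts d ∧ Summit.FinalStateConjecture.IsFutureOriented d := by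
  sorry

/-! Consistency (elaborated, not kept): each expanded stub statement is, by `δ`-unfolding, the named
proposition the composition consumes. -/
example : Goal.stub_orbitalCapture := stub_orbitalCapture
example : Goal.stub_orbitalToAsymptotic := stub_orbitalToAsymptotic

/-! ## §3 The composition (kernel-checked; no `sorry` of its own) -/

/-- **THE CRUX BY NAME from the two registered stubs.** Take the tolerance function `ε` of Stub B;
Stub A at `ε` makes orbital capture tame-generic; Stub B upgrades orbital capture to honest settling
POINTWISE on the admissible class; monotonicity of tame Christodoulou genericity in the property
(`IsTameChristodoulouGeneric.mono`) concludes. [folklore] -/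
theorem GenericSettling_of :
    Goal.stub_orbitalCapture → Goal.stub_orbitalToAsymptotic → GenericSettling := by
  intro hA hB X _ _ _ _ _ _
  obtain ⟨ε, hε, hAS⟩ := hB
  exact (hA ε hε X).mono fun D hD hq 𝒟 h𝒟 ↦ hAS X D hD 𝒟 h𝒟 (hq 𝒟 h𝒟)

/-- **The crux from the skeleton** (closed modulo the two `sorry`s). [folklore] -/
theorem GenericSettling_proof : GenericSettling :=
  GenericSettling_of stub_orbitalCapture stub_orbitalToAsymptotic

/-! ## §4 Sanity (no `sorry`): the crux implies Stub A — orbital capture is a genuine WEAKENING of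
settling (forgetful map `FinalStateDecomposition.toQuasi`; the margin is read off the finitely many
sub-extremal, orthochronously moving holes), so Stub A is true if the crux is, and the margin typing
is inhabited in kind. Stub B is implied by neither the crux nor the summit. -/

section Sanity

variable {𝓢 : Spacetime.{0} 4} {O : Set 𝓢.carrier}

/-- **Every honest decomposition has a margin**: finitely many holes with `0 < Mᵢ`, `|aᵢ| < Mᵢ` and
orthochronous motions (`(Λᵢ e₀)⁰ > 0`) admit one `m > 0` with `N ≤ 1/m`, `m ≤ Mᵢ ≤ 1/m`,
`|aᵢ| ≤ (1 − m) Mᵢ`, `(Λᵢ e₀)⁰ ≤ 1/m` (minimum of finitely many positive candidates). [folklore] -/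
theorem exists_margin (d : FinalStateDecomposition 𝓢 O 2)
    (hsub : ∀ i, Kerr.IsSubextremal (d.mass i) (d.spin i))
    (horth : ∀ i, Summit.FinalStateConjecture.IsOrthochronous (d.motion i).1) :
    ∃ m : ℝ, 0 < m ∧ (d.N : ℝ) ≤ m⁻¹ ∧ ∀ i, m ≤ d.mass i ∧ d.mass i ≤ m⁻¹ ∧
      |d.spin i| ≤ (1 - m) * d.mass i ∧ ((d.motion i).1 : E4 ≃L[ℝ] E4) (E4.basisVector 0) 0 ≤ m⁻¹ := by
  -- the Lorentz factors `γᵢ = (Λᵢ e₀)⁰ > 0`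
  set γ : Fin d.N → ℝ := fun i ↦ ((d.motion i).1 : E4 ≃L[ℝ] E4) (E4.basisVector 0) 0 with hγ
  have hγpos : ∀ i, 0 < γ i := fun i ↦ horth i
  -- per-hole candidate margins
  set c : Fin d.N → ℝ := fun i ↦
    min (min (d.mass i) (d.mass i)⁻¹) (min (1 - |d.spin i| / d.mass i) (γ i)⁻¹) with hc
  have hcpos : ∀ i, 0 < c i := by
    intro i
    have hM := d.mass_pos i
    refine lt_min (lt_min hM (inv_pos.2 hM)) (lt_min ?_ (inv_pos.2 (hγpos i)))
    rw [sub_pos, div_lt_one hM]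
    exact hsub i
  -- one more candidate for the number of holes, then the minimum of finitely many positive reals
  set f : Option (Fin d.N) → ℝ := fun o ↦ o.elim ((d.N : ℝ) + 1)⁻¹ c with hf
  have hfpos : ∀ o, 0 < f o := by
    rintro (_ | i)
    · simp only [hf, Option.elim]
      positivity
    · exact hcpos i
  obtain ⟨o₀, ho₀⟩ := Finite.exists_min f
  have hm := hfpos o₀
  refine ⟨f o₀, hm, ?_, fun i ↦ ?_⟩
  · have h : f o₀ ≤ ((d.N : ℝ) + 1)⁻¹ := ho₀ none
    have hN : (0 : ℝ) < (d.N : ℝ) + 1 := by positivity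
    calc (d.N : ℝ) ≤ (d.N : ℝ) + 1 := le_add_of_nonneg_right zero_le_one
      _ ≤ (f o₀)⁻¹ := (le_inv_comm₀ hN hm).2 h
  · have hM := d.mass_pos i
    have hle : f o₀ ≤ c i := ho₀ (some i)
    have h₁ : f o₀ ≤ d.mass i := hle.trans ((min_le_left _ _).trans (min_le_left _ _))
    have h₂ : f o₀ ≤ (d.mass i)⁻¹ := hle.trans ((min_le_left _ _).trans (min_le_right _ _))
    have h₃ : f o₀ ≤ 1 - |d.spin i| / d.mass i :=
      hle.trans ((min_le_right _ _).trans (min_le_left _ _))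
    have h₄ : f o₀ ≤ (γ i)⁻¹ := hle.trans ((min_le_right _ _).trans (min_le_right _ _))
    refine ⟨h₁, (le_inv_comm₀ hm hM).1 h₂, ?_, (le_inv_comm₀ hm (hγpos i)).1 h₄⟩
    have h₃' : |d.spin i| / d.mass i ≤ 1 - f o₀ := by linarith
    exact (div_le_iff₀ hM).1 h₃'

variable {X : Type} [TopologicalSpace X] [ChartedSpace E3 X] [IsManifold (𝓡 3) ∞ X]
  [ConnectedSpace X]

/-- **Settling is orbital capture at every positive tolerance** (pointwise, same MGHD): the
forgetful map `FinalStateDecomposition.toQuasi` keeps every chart, so `O`, `charted`, the certified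
regions, the rays clause and the orientation clauses are untouched; convergence out to the honest
radii gives eventual `ε(m)`-closeness; the margin is `exists_margin`. Klainerman 2025, §2.3
("the second notion is far stronger"). [cite: Klainerman2025, §2.3] -/
theorem quasiSettles_of_settles (ε : ℝ → ℝ≥0∞) (hε : ∀ m, 0 < m → 0 < ε m)
    {D : InitialDataSet (𝓡 3) X} {𝒟 : VacuumCauchyDevelopment D} (h : Settles 𝒟) :
    QuasiSettles ε 𝒟 := by
  obtain ⟨O, d, hsub, hO, hR, ⟨R, hhon, htend, hcov⟩, horth, hV, hflat⟩ := h
  obtain ⟨m, hm, hN, hhole⟩ := exists_margin d hsub horth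
  refine ⟨m, O, d.toQuasi (hε m hm), hm, ⟨hN, hhole⟩, hO, hR,
    ⟨R, hhon, fun i ↦ (htend i).eventually (ge_mem_nhds (hε m hm)), hcov⟩, horth, hV, hflat⟩

/-- **The crux implies Stub A** (monotonicity of tame genericity + `quasiSettles_of_settles`).
[folklore] -/
theorem orbitalCapture_of_crux (h : GenericSettling) : OrbitalCapture := by
  intro ε hε X _ _ _ _ _ _
  exact (h X).mono fun D _ hS 𝒟 h𝒟 ↦ quasiSettles_of_settles ε hε (hS 𝒟 h𝒟)

end Sanity

end Summit.FinalStateConjecture.FinalStateConjecture.Cruxes.GenericSettling.Birth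

end
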